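import Summits.AtomisticToContinuum.Crystallization.Theorems.FrustratedLawDichotomyCoherentFloorAlgebra

/-!
# DROWS-SOUND, piece (s4): soundness of the outward fixed-point arithmetic of the D-ROWS K files

decomp-a2c hand-2 g46 — structural share for `AperiodicFrustratedLawGap` (stmt-27623), class-D rows of the hdef atlas
(critic r1757 (C)(b) registration «DROWS-SOUND» (s1)–(s5); lens-5 g112: «(s1)/(s4) = K-file lane»).
The census K certificates `…DRowsBcc / …DRowsA15 / …DRowsC15` (census-1 g53) evaluate, in `ℤ` fixed point at a scale `S`
(there `2⁶⁰`) with OUTWARD rounding (`fdiv a b := Int.fdiv a b` down, `cdiv a b := -Int.fdiv (-a) b` up), a lower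
bound of a template's root energy from the pieces `phiLo`/`phiHi` (bounds of `S·φ(p/q)`, `φ(t) = t⁻⁶/12 − t⁻³/6` = the
tree's `…CoherentFloorAlgebra.phiT`, `V_LJ(r) = phiT (r²)`), `phiMinLo` (shell minimum, piece (s2)), `envHi` (bound of
`S·Env₆/12`, `Env₆(δ,R) = (2/δ)³R⁻³ + (15/2)(2/δ)²R⁻⁴ + (3/5)(2/δ)R⁻⁵ + 2R⁻⁶` = the `k = 3` instance of TREE
`…FarFieldSharp.sum_inv_pow_le_of_separated_sharp`, piece (s3), at `δ = slo/sDen`, `R = 10·slo/shi`), the fold `shellSum`,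
`sigmaLo = fdiv shellSum 2 − envHi − eUp`, `leafOK = (BAR ≤ sigmaLo)`, `BAR = cdiv (27·S) 1000`.
This file is DEF-FREE and GENERIC IN `S`: every theorem is stated on the UNFOLDED bodies of those definitions (for the
multi-`let` bodies also in «named-intermediates» form, one `rfl`-dischargeable equation per `let`), so each K file gets
its soundness lemmas by `unfold phiLo fdiv cdiv; exact …` and the three template files (byte-identical arithmetic) share
one proof.  §1 `fdiv`/`cdiv` vs real division · §2 rounded scaled products · §3 `phiLo ≤ S·φ ≤ phiHi` · §4 the shell
minimum for ANY `φ` antitone left of `1` / monotone right of `1` (hypotheses = lens-5's (s2) lemmas) · §5 `S·Env₆/12 ≤ envHi`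
+ the literal `k = 3` envelope shape · §6 the histogram fold · §7 `leafOK ⇒ 27/1000 ≤ ½·ShellSum − Env₆/12 − E_UP` over `ℝ`.
-/

namespace Summit.AtomisticToContinuum.Crystallization.Theorems.FrustratedLawDichotomyDRowsArith

open Summit.AtomisticToContinuum.Crystallization.Theorems.FrustratedLawDichotomyCoherentFloorAlgebra (phiT)

/-! ## §1 Floor and ceiling division by a positive integer -/
/-- `Int.fdiv a b ≤ a/b` over `ℝ` for `0 < b` (round down). -/
theorem cast_fdiv_le {a b : ℤ} (hb : 0 < b) : ((Int.fdiv a b : ℤ) : ℝ) ≤ (a : ℝ) / b := by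
  rw [Int.fdiv_eq_ediv_of_nonneg _ hb.le, le_div_iff₀ (by exact_mod_cast hb)]
  exact_mod_cast Int.ediv_mul_le a hb.ne'

/-- `a/b ≤ -Int.fdiv (-a) b` over `ℝ` for `0 < b` (round up; the K files' `cdiv`). -/
theorem le_cast_cdiv {a b : ℤ} (hb : 0 < b) : (a : ℝ) / b ≤ ((-Int.fdiv (-a) b : ℤ) : ℝ) := by
  have h := cast_fdiv_le (a := -a) hb
  push_cast at h ⊢
  rw [neg_div] at h
  linarith

/-- `Int.fdiv` of a nonnegative numerator by a positive denominator is nonnegative. -/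
theorem fdiv_nonneg {a b : ℤ} (ha : 0 ≤ a) (hb : 0 < b) : 0 ≤ Int.fdiv a b := by
  rw [Int.fdiv_eq_ediv_of_nonneg _ hb.le]
  exact Int.ediv_nonneg ha hb.le

/-- round down under an upper bound of the numerator. -/
theorem cast_fdiv_le_of_le {a b : ℤ} {x : ℝ} (hb : 0 < b) (h : (a : ℝ) ≤ x) :
    ((Int.fdiv a b : ℤ) : ℝ) ≤ x / b :=
  (cast_fdiv_le hb).trans (div_le_div_of_nonneg_right h (by exact_mod_cast hb.le))

/-- round up over a lower bound of the numerator. -/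
theorem le_cast_cdiv_of_le {a b : ℤ} {x : ℝ} (hb : 0 < b) (h : x ≤ (a : ℝ)) :
    x / b ≤ ((-Int.fdiv (-a) b : ℤ) : ℝ) :=
  (div_le_div_of_nonneg_right h (by exact_mod_cast hb.le)).trans (le_cast_cdiv hb)

/-! ## §2 Rounded products at scale `S`

`X ≤ S·x` reads «`X` is a scale-`S` lower reading of `x`», `S·x ≤ X` an upper reading. -/

/-- lower product: from nonnegative lower readings of `x` and `y`, `fdiv (a·b) S` is a lower reading of `x·y`. -/
theorem fdiv_mul_le {S a b : ℤ} {x y : ℝ} (hS : 0 < S) (ha0 : 0 ≤ a) (ha : (a : ℝ) ≤ S * x)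
    (hb0 : 0 ≤ b) (hb : (b : ℝ) ≤ S * y) :
    ((Int.fdiv (a * b) S : ℤ) : ℝ) ≤ S * (x * y) := by
  have hS' : (0 : ℝ) < S := by exact_mod_cast hS
  have ha0' : (0 : ℝ) ≤ a := by exact_mod_cast ha0
  have hb0' : (0 : ℝ) ≤ b := by exact_mod_cast hb0
  have hab : ((a * b : ℤ) : ℝ) ≤ (S * x) * (S * y) := by
    push_cast
    exact mul_le_mul ha hb hb0' (ha0'.trans ha)
  calc ((Int.fdiv (a * b) S : ℤ) : ℝ) ≤ (S * x) * (S * y) / S := cast_fdiv_le_of_le hS hab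
    _ = S * (x * y) := by field_simp

/-- the lower product of nonnegative readings is nonnegative. -/
theorem fdiv_mul_nonneg {S a b : ℤ} (hS : 0 < S) (ha0 : 0 ≤ a) (hb0 : 0 ≤ b) : 0 ≤ Int.fdiv (a * b) S :=
  fdiv_nonneg (mul_nonneg ha0 hb0) hS

/-- upper product: from upper readings of nonnegative `x` and `y`, `cdiv (a·b) S` is an upper reading of `x·y`. -/
theorem mul_le_cdiv {S a b : ℤ} {x y : ℝ} (hS : 0 < S) (hx0 : 0 ≤ x) (ha : S * x ≤ (a : ℝ))
    (hy0 : 0 ≤ y) (hb : S * y ≤ (b : ℝ)) :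
    S * (x * y) ≤ ((-Int.fdiv (-(a * b)) S : ℤ) : ℝ) := by
  have hS' : (0 : ℝ) < S := by exact_mod_cast hS
  have hab : (S * x) * (S * y) ≤ ((a * b : ℤ) : ℝ) := by
    push_cast
    exact mul_le_mul ha hb (by positivity) ((by positivity : (0 : ℝ) ≤ S * x).trans ha)
  calc S * (x * y) = (S * x) * (S * y) / S := by field_simp
    _ ≤ _ := le_cast_cdiv_of_le hS hab

/-- a lower reading divided (rounding down) by a positive literal. -/
theorem fdiv_nat_le {a n : ℤ} {S : ℤ} {x : ℝ} (hn : 0 < n) (ha : (a : ℝ) ≤ S * x) :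
    ((Int.fdiv a n : ℤ) : ℝ) ≤ S * (x / n) := by
  have := cast_fdiv_le_of_le hn ha
  simpa [mul_div_assoc] using this

/-- an upper reading divided (rounding up) by a positive literal. -/
theorem le_cdiv_nat {a n : ℤ} {S : ℤ} {x : ℝ} (hn : 0 < n) (ha : S * x ≤ (a : ℝ)) :
    S * (x / n) ≤ ((-Int.fdiv (-a) n : ℤ) : ℝ) := by
  have := le_cast_cdiv_of_le hn ha
  simpa [mul_div_assoc] using this

/-- an upper reading times a nonnegative literal. -/
theorem le_nat_mul {a n : ℤ} {S : ℤ} {x : ℝ} (hn : 0 ≤ n) (ha : S * x ≤ (a : ℝ)) :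
    S * (n * x) ≤ ((n * a : ℤ) : ℝ) := by
  push_cast
  have hn' : (0 : ℝ) ≤ n := by exact_mod_cast hn
  nlinarith

/-! ## §3 `phiLo ≤ S·φ(p/q) ≤ phiHi` -/
/-- `phiLo` is a lower reading of `φ(p/q)` — named-intermediates form (one equation per `let` of the K files' `phiLo`). -/
theorem phiLo_le_aux {S p q wlo whi w2lo w2hi w3lo w3hi w6lo : ℤ} (hS : 0 < S) (hp : 0 < p) (hq : 0 < q)
    (h1 : wlo = Int.fdiv (S * q) p) (h2 : whi = -Int.fdiv (-(S * q)) p)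
    (h3 : w2lo = Int.fdiv (wlo * wlo) S) (h4 : w2hi = -Int.fdiv (-(whi * whi)) S)
    (h5 : w3lo = Int.fdiv (w2lo * wlo) S) (h6 : w3hi = -Int.fdiv (-(w2hi * whi)) S)
    (h7 : w6lo = Int.fdiv (w3lo * w3lo) S) :
    ((Int.fdiv w6lo 12 - -Int.fdiv (-w3hi) 6 : ℤ) : ℝ) ≤ S * phiT ((p : ℝ) / q) := by
  have hp' : (0 : ℝ) < p := by exact_mod_cast hp
  have hq' : (0 : ℝ) < q := by exact_mod_cast hq
  set w : ℝ := (q : ℝ) / p with hw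
  have hw0 : 0 ≤ w := by positivity
  -- the readings of w
  have e1 : ((S * q : ℤ) : ℝ) / p = S * w := by push_cast; rw [hw]; ring
  have hwlo : (wlo : ℝ) ≤ S * w := by rw [h1, ← e1]; exact cast_fdiv_le hp
  have hwlo0 : 0 ≤ wlo := by rw [h1]; exact fdiv_nonneg (by positivity) hp
  have hwhi : S * w ≤ (whi : ℝ) := by rw [h2, ← e1]; exact le_cast_cdiv hp
  -- powers
  have hw2lo : (w2lo : ℝ) ≤ S * (w * w) := by rw [h3]; exact fdiv_mul_le hS hwlo0 hwlo hwlo0 hwlo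
  have hw2lo0 : 0 ≤ w2lo := by rw [h3]; exact fdiv_mul_nonneg hS hwlo0 hwlo0
  have hw2hi : S * (w * w) ≤ (w2hi : ℝ) := by rw [h4]; exact mul_le_cdiv hS hw0 hwhi hw0 hwhi
  have hw3lo : (w3lo : ℝ) ≤ S * (w * w * w) := by rw [h5]; exact fdiv_mul_le hS hw2lo0 hw2lo hwlo0 hwlo
  have hw3lo0 : 0 ≤ w3lo := by rw [h5]; exact fdiv_mul_nonneg hS hw2lo0 hwlo0
  have hw3hi : S * (w * w * w) ≤ (w3hi : ℝ) := by
    rw [h6]; exact mul_le_cdiv hS (by positivity) hw2hi hw0 hwhi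
  have hw6lo : (w6lo : ℝ) ≤ S * (w * w * w * (w * w * w)) := by
    rw [h7]; exact fdiv_mul_le hS hw3lo0 hw3lo hw3lo0 hw3lo
  -- the two rounded terms
  have t1 : ((Int.fdiv w6lo 12 : ℤ) : ℝ) ≤ S * (w * w * w * (w * w * w) / 12) := fdiv_nat_le (by norm_num) hw6lo
  have t2 : S * (w * w * w / 6) ≤ ((-Int.fdiv (-w3hi) 6 : ℤ) : ℝ) := le_cdiv_nat (by norm_num) hw3hi
  have eφ : phiT ((p : ℝ) / q) = w * w * w * (w * w * w) / 12 - w * w * w / 6 := by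
    rw [phiT, inv_div, ← hw]; ring
  rw [eφ]
  push_cast at t1 t2 ⊢
  linarith

/-- ★ `phiLo p q ≤ S·φ(p/q)` on the `let`-body of the K files' `phiLo` (scale `S` generic; K side: `unfold phiLo fdiv cdiv; exact phiLo_le S p q hS hp hq`). -/
theorem phiLo_le (S p q : ℤ) (hS : 0 < S) (hp : 0 < p) (hq : 0 < q) :
    ((let wlo := Int.fdiv (S * q) p
      let whi := -Int.fdiv (-(S * q)) p
      let w2lo := Int.fdiv (wlo * wlo) S
      let w2hi := -Int.fdiv (-(whi * whi)) S
      let w3lo := Int.fdiv (w2lo * wlo) S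
      let w3hi := -Int.fdiv (-(w2hi * whi)) S
      let w6lo := Int.fdiv (w3lo * w3lo) S
      Int.fdiv w6lo 12 - -Int.fdiv (-w3hi) 6 : ℤ) : ℝ) ≤ S * phiT ((p : ℝ) / q) := by
  dsimp only
  exact phiLo_le_aux hS hp hq rfl rfl rfl rfl rfl rfl rfl

/-- `phiHi` is an upper reading of `φ(p/q)` — named-intermediates form. -/
theorem le_phiHi_aux {S p q wlo whi w2lo w2hi w3lo w3hi w6hi : ℤ} (hS : 0 < S) (hp : 0 < p) (hq : 0 < q)
    (h1 : wlo = Int.fdiv (S * q) p) (h2 : whi = -Int.fdiv (-(S * q)) p)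
    (h3 : w2lo = Int.fdiv (wlo * wlo) S) (h4 : w2hi = -Int.fdiv (-(whi * whi)) S)
    (h5 : w3lo = Int.fdiv (w2lo * wlo) S) (h6 : w3hi = -Int.fdiv (-(w2hi * whi)) S)
    (h7 : w6hi = -Int.fdiv (-(w3hi * w3hi)) S) :
    S * phiT ((p : ℝ) / q) ≤ ((-Int.fdiv (-w6hi) 12 - Int.fdiv w3lo 6 : ℤ) : ℝ) := by
  have hp' : (0 : ℝ) < p := by exact_mod_cast hp
  have hq' : (0 : ℝ) < q := by exact_mod_cast hq
  set w : ℝ := (q : ℝ) / p with hw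
  have hw0 : 0 ≤ w := by positivity
  have e1 : ((S * q : ℤ) : ℝ) / p = S * w := by push_cast; rw [hw]; ring
  have hwlo : (wlo : ℝ) ≤ S * w := by rw [h1, ← e1]; exact cast_fdiv_le hp
  have hwlo0 : 0 ≤ wlo := by rw [h1]; exact fdiv_nonneg (by positivity) hp
  have hwhi : S * w ≤ (whi : ℝ) := by rw [h2, ← e1]; exact le_cast_cdiv hp
  have hw2lo : (w2lo : ℝ) ≤ S * (w * w) := by rw [h3]; exact fdiv_mul_le hS hwlo0 hwlo hwlo0 hwlo
  have hw2lo0 : 0 ≤ w2lo := by rw [h3]; exact fdiv_mul_nonneg hS hwlo0 hwlo0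
  have hw2hi : S * (w * w) ≤ (w2hi : ℝ) := by rw [h4]; exact mul_le_cdiv hS hw0 hwhi hw0 hwhi
  have hw3lo : (w3lo : ℝ) ≤ S * (w * w * w) := by rw [h5]; exact fdiv_mul_le hS hw2lo0 hw2lo hwlo0 hwlo
  have hw3hi : S * (w * w * w) ≤ (w3hi : ℝ) := by
    rw [h6]; exact mul_le_cdiv hS (by positivity) hw2hi hw0 hwhi
  have hw6hi : S * (w * w * w * (w * w * w)) ≤ (w6hi : ℝ) := by
    rw [h7]; exact mul_le_cdiv hS (by positivity) hw3hi (by positivity) hw3hi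
  have t1 : S * (w * w * w * (w * w * w) / 12) ≤ ((-Int.fdiv (-w6hi) 12 : ℤ) : ℝ) := le_cdiv_nat (by norm_num) hw6hi
  have t2 : ((Int.fdiv w3lo 6 : ℤ) : ℝ) ≤ S * (w * w * w / 6) := fdiv_nat_le (by norm_num) hw3lo
  have eφ : phiT ((p : ℝ) / q) = w * w * w * (w * w * w) / 12 - w * w * w / 6 := by
    rw [phiT, inv_div, ← hw]; ring
  rw [eφ]
  push_cast at t1 t2 ⊢
  linarith

/-- ★ `S·φ(p/q) ≤ phiHi p q` on the `let`-body of the K files' `phiHi`. -/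
theorem le_phiHi (S p q : ℤ) (hS : 0 < S) (hp : 0 < p) (hq : 0 < q) :
    S * phiT ((p : ℝ) / q) ≤
      ((let wlo := Int.fdiv (S * q) p
        let whi := -Int.fdiv (-(S * q)) p
        let w2lo := Int.fdiv (wlo * wlo) S
        let w2hi := -Int.fdiv (-(whi * whi)) S
        let w3lo := Int.fdiv (w2lo * wlo) S
        let w3hi := -Int.fdiv (-(w2hi * whi)) S
        let w6hi := -Int.fdiv (-(w3hi * w3hi)) S;
        -Int.fdiv (-w6hi) 12 - Int.fdiv w3lo 6 : ℤ) : ℝ) := by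
  dsimp only
  exact le_phiHi_aux hS hp hq rfl rfl rfl rfl rfl rfl rfl

/-! ## §4 The shell minimum (piece (s2) ∘ (s4)), for any `φ` antitone on `(0,1]` and monotone on `[1,∞)` -/
/-- ★ generic soundness of the K files' `phiMinLo plo phi q := if phi ≤ q then lo phi q else if q ≤ plo then lo plo q else c`:
with `lo` any lower reading of `S·φ` (e.g. `phiLo`, by `phiLo_le`), `φ` antitone left of `1` and monotone right of `1`,
and `c` a lower reading of `S·φ` on `(0,∞)` (for `φ = phiT`: `c = −cdiv S 12`, `−1/12 ≤ phiT`), the value is a lower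
reading of `S·φ(t)` at EVERY `t` of the shell window `[plo/q, phi/q]`.  The three hypotheses on `φ` are lens-5's (s2)
lemmas `phiT_le_phiT_of_le_one`, `phiT_le_phiT_of_one_le`, `neg_twelfth_le_phiT` (…ShellMinimum). -/
theorem minLo_le {S q plo phi c : ℤ} {φ : ℝ → ℝ} {lo : ℤ → ℤ → ℤ} (hq : 0 < q) (hplo : 0 < plo)
    (hlo : ∀ p : ℤ, 0 < p → ((lo p q : ℤ) : ℝ) ≤ S * φ ((p : ℝ) / q))
    (hanti : ∀ s t : ℝ, 0 < s → s ≤ t → t ≤ 1 → φ t ≤ φ s)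
    (hmono : ∀ s t : ℝ, 1 ≤ s → s ≤ t → φ s ≤ φ t)
    (hc : ∀ t : ℝ, 0 < t → (c : ℝ) ≤ S * φ t) (hS : 0 ≤ S)
    {t : ℝ} (h1 : (plo : ℝ) / q ≤ t) (h2 : t ≤ (phi : ℝ) / q) :
    ((if phi ≤ q then lo phi q else if q ≤ plo then lo plo q else c : ℤ) : ℝ) ≤ S * φ t := by
  have hq' : (0 : ℝ) < q := by exact_mod_cast hq
  have hplo' : (0 : ℝ) < plo := by exact_mod_cast hplo
  have htlo : (0 : ℝ) < (plo : ℝ) / q := by positivity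
  have ht : 0 < t := htlo.trans_le h1
  have hS' : (0 : ℝ) ≤ S := by exact_mod_cast hS
  split_ifs with hA hB
  · -- window left of the well: the minimum sits at the right end `phi/q ≤ 1`
    have hphi : 0 < phi := by
      have h0 : (0 : ℝ) < (phi : ℝ) / q := ht.trans_le h2
      exact_mod_cast (div_pos_iff_of_pos_right hq').1 h0
    have hle1 : (phi : ℝ) / q ≤ 1 := by
      rw [div_le_one hq']; exact_mod_cast hA
    exact (hlo phi hphi).trans (mul_le_mul_of_nonneg_left (hanti t _ ht h2 hle1) hS')
  · -- window right of the well: the minimum sits at the left end `plo/q ≥ 1`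
    have h1le : (1 : ℝ) ≤ (plo : ℝ) / q := by
      rw [one_le_div hq']; exact_mod_cast hB
    exact (hlo plo hplo).trans (mul_le_mul_of_nonneg_left (hmono _ t h1le h1) hS')
  · exact hc t ht

/-- the constant branch for `φ = phiT`: `−cdiv S 12 ≤ S·phiT t` from `−1/12 ≤ phiT` (lens-5 (s2); here from the tree's
`neg_one_div_le_lennardJones` shape re-proved on `phiT` in one line to stay import-light). -/
theorem neg_cdiv_twelve_le (S : ℤ) (hS : 0 ≤ S) (t : ℝ) :
    ((-(-Int.fdiv (-S) 12) : ℤ) : ℝ) ≤ S * phiT t := by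
  have h12 : ((S : ℝ)) / 12 ≤ ((-Int.fdiv (-S) 12 : ℤ) : ℝ) := le_cast_cdiv (by norm_num)
  have hφ : -(1 / 12 : ℝ) ≤ phiT t := by
    have h : (0 : ℝ) ≤ 1 / 12 * (t⁻¹ ^ 3 - 1) ^ 2 := by positivity
    unfold phiT; linarith [h]
  have hS' : (0 : ℝ) ≤ S := by exact_mod_cast hS
  have hm := mul_le_mul_of_nonneg_left hφ hS'
  push_cast at h12 ⊢
  linarith

/-! ## §5 The far-field envelope `S·Env₆/12 ≤ envHi` (piece (s3) ∘ (s4)) -/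
/-- `envHi` is an upper reading of `(1/12)·Env₆(δ, R)` at `δ = slo/sDen`, `R = 10·slo/shi` — named-intermediates form
(one equation per `let` of the K files' `envHi`, after `slo := sNum i`, `shi := sNum (i+1)`). -/
theorem le_envHi_aux {S sDen slo shi uhi rinv u2 u3 r2 r3 r4 r5 r6 t1 t2 t3 t4 : ℤ}
    (hS : 0 < S) (hD : 0 < sDen) (hlo : 0 < slo) (hhi : 0 < shi)
    (e1 : uhi = -Int.fdiv (-(2 * sDen * S)) slo) (e2 : rinv = -Int.fdiv (-(shi * S)) (slo * 10))
    (e3 : u2 = -Int.fdiv (-(uhi * uhi)) S) (e4 : u3 = -Int.fdiv (-(u2 * uhi)) S)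
    (e5 : r2 = -Int.fdiv (-(rinv * rinv)) S) (e6 : r3 = -Int.fdiv (-(r2 * rinv)) S)
    (e7 : r4 = -Int.fdiv (-(r3 * rinv)) S) (e8 : r5 = -Int.fdiv (-(r4 * rinv)) S)
    (e9 : r6 = -Int.fdiv (-(r5 * rinv)) S) (e10 : t1 = -Int.fdiv (-(u3 * r3)) S)
    (e11 : t2 = -Int.fdiv (-(15 * -Int.fdiv (-(u2 * r4)) S)) 2)
    (e12 : t3 = -Int.fdiv (-(3 * -Int.fdiv (-(uhi * r5)) S)) 5) (e13 : t4 = 2 * r6)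
    {δ R : ℝ} (hδ : δ = (slo : ℝ) / sDen) (hR : R = 10 * (slo : ℝ) / shi) :
    S * (1 / 12 * ((2 / δ) ^ 3 * R⁻¹ ^ 3 + 15 / 2 * (2 / δ) ^ 2 * R⁻¹ ^ 4 + 3 / 5 * (2 / δ) * R⁻¹ ^ 5 + 2 * R⁻¹ ^ 6)) ≤
      ((-Int.fdiv (-(t1 + t2 + t3 + t4)) 12 : ℤ) : ℝ) := by
  have hS' : (0 : ℝ) < S := by exact_mod_cast hS
  have hD' : (0 : ℝ) < sDen := by exact_mod_cast hD
  have hlo' : (0 : ℝ) < slo := by exact_mod_cast hlo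
  have hhi' : (0 : ℝ) < shi := by exact_mod_cast hhi
  set u : ℝ := 2 * (sDen : ℝ) / slo with hu
  set ρ : ℝ := (shi : ℝ) / (10 * slo) with hρ
  have hu0 : 0 ≤ u := by positivity
  have hρ0 : 0 ≤ ρ := by positivity
  have eu : 2 / δ = u := by rw [hδ, hu, div_div_eq_mul_div]
  have eρ : R⁻¹ = ρ := by rw [hR, hρ, inv_div]
  rw [eu, eρ]
  -- first readings
  have huhi : S * u ≤ (uhi : ℝ) := by
    have h := le_cast_cdiv (a := 2 * sDen * S) hlo
    have e : ((2 * sDen * S : ℤ) : ℝ) / slo = S * u := by rw [hu]; push_cast; ring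
    rw [e1, ← e]; exact h
  have hrinv : S * ρ ≤ (rinv : ℝ) := by
    have h := le_cast_cdiv (a := shi * S) (b := slo * 10) (by positivity)
    have e : ((shi * S : ℤ) : ℝ) / ((slo * 10 : ℤ) : ℝ) = S * ρ := by rw [hρ]; push_cast; ring
    rw [e2, ← e]; exact h
  -- powers
  have hu2 : S * (u * u) ≤ (u2 : ℝ) := by rw [e3]; exact mul_le_cdiv hS hu0 huhi hu0 huhi
  have hu3 : S * (u * u * u) ≤ (u3 : ℝ) := by rw [e4]; exact mul_le_cdiv hS (by positivity) hu2 hu0 huhi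
  have hr2 : S * (ρ * ρ) ≤ (r2 : ℝ) := by rw [e5]; exact mul_le_cdiv hS hρ0 hrinv hρ0 hrinv
  have hr3 : S * (ρ * ρ * ρ) ≤ (r3 : ℝ) := by rw [e6]; exact mul_le_cdiv hS (by positivity) hr2 hρ0 hrinv
  have hr4 : S * (ρ * ρ * ρ * ρ) ≤ (r4 : ℝ) := by rw [e7]; exact mul_le_cdiv hS (by positivity) hr3 hρ0 hrinv
  have hr5 : S * (ρ * ρ * ρ * ρ * ρ) ≤ (r5 : ℝ) := by rw [e8]; exact mul_le_cdiv hS (by positivity) hr4 hρ0 hrinv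
  have hr6 : S * (ρ * ρ * ρ * ρ * ρ * ρ) ≤ (r6 : ℝ) := by
    rw [e9]; exact mul_le_cdiv hS (by positivity) hr5 hρ0 hrinv
  -- the four terms
  have ht1 : S * (u * u * u * (ρ * ρ * ρ)) ≤ (t1 : ℝ) := by
    rw [e10]; exact mul_le_cdiv hS (by positivity) hu3 (by positivity) hr3
  have ht2 : S * (15 * (u * u * (ρ * ρ * ρ * ρ)) / 2) ≤ (t2 : ℝ) := by
    have h24 : S * (u * u * (ρ * ρ * ρ * ρ)) ≤ ((-Int.fdiv (-(u2 * r4)) S : ℤ) : ℝ) :=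
      mul_le_cdiv hS (by positivity) hu2 (by positivity) hr4
    have h15 := le_nat_mul (n := 15) (by norm_num) h24
    rw [e11]; exact le_cdiv_nat (by norm_num) h15
  have ht3 : S * (3 * (u * (ρ * ρ * ρ * ρ * ρ)) / 5) ≤ (t3 : ℝ) := by
    have h15 : S * (u * (ρ * ρ * ρ * ρ * ρ)) ≤ ((-Int.fdiv (-(uhi * r5)) S : ℤ) : ℝ) :=
      mul_le_cdiv hS hu0 huhi (by positivity) hr5
    have h3 := le_nat_mul (n := 3) (by norm_num) h15
    rw [e12]; exact le_cdiv_nat (by norm_num) h3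
  have ht4 : S * (2 * (ρ * ρ * ρ * ρ * ρ * ρ)) ≤ (t4 : ℝ) := by
    rw [e13]; push_cast; nlinarith [hr6]
  have hsum : S * (u * u * u * (ρ * ρ * ρ) + 15 * (u * u * (ρ * ρ * ρ * ρ)) / 2 + 3 * (u * (ρ * ρ * ρ * ρ * ρ)) / 5 +
      2 * (ρ * ρ * ρ * ρ * ρ * ρ)) ≤ ((t1 + t2 + t3 + t4 : ℤ) : ℝ) := by
    push_cast; nlinarith [ht1, ht2, ht3, ht4]
  have hfin := le_cdiv_nat (n := 12) (by norm_num) hsum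
  convert hfin using 2
  ring

/-- ★ `S·(1/12)·Env₆(δ, R) ≤ envHi` at `δ = slo/sDen`, `R = 10·slo/shi`, on the `let`-body of the K files' `envHi` (scale `S`
and `sDen` generic; K side: `unfold envHi cdiv; exact le_envHi S sDen (sNum i) (sNum (i+1)) … rfl rfl`). -/
theorem le_envHi (S sDen slo shi : ℤ) (hS : 0 < S) (hD : 0 < sDen) (hlo : 0 < slo) (hhi : 0 < shi)
    {δ R : ℝ} (hδ : δ = (slo : ℝ) / sDen) (hR : R = 10 * (slo : ℝ) / shi) :
    S * (1 / 12 * ((2 / δ) ^ 3 * R⁻¹ ^ 3 + 15 / 2 * (2 / δ) ^ 2 * R⁻¹ ^ 4 + 3 / 5 * (2 / δ) * R⁻¹ ^ 5 + 2 * R⁻¹ ^ 6)) ≤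
      ((let uhi := -Int.fdiv (-(2 * sDen * S)) slo
        let rinv := -Int.fdiv (-(shi * S)) (slo * 10)
        let u2 := -Int.fdiv (-(uhi * uhi)) S
        let u3 := -Int.fdiv (-(u2 * uhi)) S
        let r2 := -Int.fdiv (-(rinv * rinv)) S
        let r3 := -Int.fdiv (-(r2 * rinv)) S
        let r4 := -Int.fdiv (-(r3 * rinv)) S
        let r5 := -Int.fdiv (-(r4 * rinv)) S
        let r6 := -Int.fdiv (-(r5 * rinv)) S
        let t1 := -Int.fdiv (-(u3 * r3)) S
        let t2 := -Int.fdiv (-(15 * -Int.fdiv (-(u2 * r4)) S)) 2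
        let t3 := -Int.fdiv (-(3 * -Int.fdiv (-(uhi * r5)) S)) 5
        let t4 := 2 * r6;
        -Int.fdiv (-(t1 + t2 + t3 + t4)) 12 : ℤ) : ℝ) := by
  dsimp only
  exact le_envHi_aux hS hD hlo hhi rfl rfl rfl rfl rfl rfl rfl rfl rfl rfl rfl rfl rfl hδ hR

/-- the `k = 3` instance of the tree envelope `…FarFieldSharp.sum_inv_pow_le_of_separated_sharp`'s right-hand side IS
`Env₆(δ, R)` (pure arithmetic of the literal coefficients `3/k`, `6(k+2)/(k+1)`, `3/(k+2)` at `k = 3`). -/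
theorem envelope_three_eq (δ R : ℝ) :
    3 / ((3 : ℕ) : ℝ) * (2 / δ) ^ 3 * R⁻¹ ^ (3 : ℕ) +
        6 * (((3 : ℕ) : ℝ) + 2) / (((3 : ℕ) : ℝ) + 1) * (2 / δ) ^ 2 * R⁻¹ ^ ((3 : ℕ) + 1) +
        3 / (((3 : ℕ) : ℝ) + 2) * (2 / δ) * R⁻¹ ^ ((3 : ℕ) + 2) + 2 * R⁻¹ ^ ((3 : ℕ) + 3) =
      (2 / δ) ^ 3 * R⁻¹ ^ 3 + 15 / 2 * (2 / δ) ^ 2 * R⁻¹ ^ 4 + 3 / 5 * (2 / δ) * R⁻¹ ^ 5 + 2 * R⁻¹ ^ 6 := by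
  simp only [Nat.cast_ofNat]
  ring

/-! ## §6 The histogram fold (`shellSum`) -/
/-- ★ generic soundness of a left fold of the K files' `shellSum` shape, characterised by its two defining equations
(K side: both by `rfl` / `simp only [shellSum]`): if every booked per-shell value `g D` is a lower reading of `G D`, the
fold is a lower reading of `acc/S + Σ_(D,m) ∈ h, P D  m·G D`. -/
theorem shellFold_le {f : List (ℕ × ℕ) → ℤ → ℤ} {P : ℕ → Bool} {g : ℕ → ℤ} {G : ℕ → ℝ} {S : ℤ}
    (hnil : ∀ acc, f [] acc = acc)
    (hcons : ∀ D m rest acc, f ((D, m) :: rest) acc = f rest (if P D then acc + (m : ℤ) * g D else acc))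
    (hg : ∀ D, P D = true → ((g D : ℤ) : ℝ) ≤ S * G D) :
    ∀ (h : List (ℕ × ℕ)) (acc : ℤ),
      ((f h acc : ℤ) : ℝ) ≤ acc + S * (h.map fun Dm => if P Dm.1 then (Dm.2 : ℝ) * G Dm.1 else 0).sum := by
  intro h
  induction h with
  | nil => intro acc; simp [hnil]
  | cons Dm rest ih =>
    intro acc
    obtain ⟨D, m⟩ := Dm
    rw [hcons, List.map_cons, List.sum_cons]
    by_cases hP : P D = true
    · simp only [hP, ↓reduceIte]
      refine (ih _).trans ?_
      have := hg D hP
      have hm : (0 : ℝ) ≤ m := by exact_mod_cast Nat.zero_le m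
      push_cast
      nlinarith
    · simp only [hP]
      refine (ih _).trans ?_
      simp

/-! ## §7 The leaf inequality over `ℝ` -/
/-- `BAR = cdiv (27·S) 1000` is an upper reading of `27/1000`. -/
theorem bar_ge (S : ℤ) : S * (27 / 1000 : ℝ) ≤ ((-Int.fdiv (-(27 * S)) 1000 : ℤ) : ℝ) := by
  have := le_cast_cdiv (a := 27 * S) (b := 1000) (by norm_num)
  convert this using 1; push_cast; ring

/-- ★ leaf soundness over `ℝ`: if the shell fold `sh` is a lower reading of `Sr`, `env` an upper reading of the envelope
term `Er`, and the K file's Boolean `leafOK` holds, i.e. `BAR ≤ fdiv sh 2 − env − eup` in `ℤ`, then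
`27/1000 ≤ Sr/2 − Er − eup/S`. -/
theorem leaf_sound {S sh env eup : ℤ} {Sr Er : ℝ} (hS : 0 < S) (hsh : (sh : ℝ) ≤ S * Sr)
    (henv : S * Er ≤ (env : ℝ)) (hok : -Int.fdiv (-(27 * S)) 1000 ≤ Int.fdiv sh 2 - env - eup) :
    27 / 1000 ≤ Sr / 2 - Er - (eup : ℝ) / S := by
  have hS' : (0 : ℝ) < S := by exact_mod_cast hS
  have hS0 : (S : ℝ) ≠ 0 := hS'.ne'
  have h2 : ((Int.fdiv sh 2 : ℤ) : ℝ) ≤ S * (Sr / 2) := fdiv_nat_le (by norm_num) hsh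
  have hbar := bar_ge S
  have hok' : ((-Int.fdiv (-(27 * S)) 1000 : ℤ) : ℝ) ≤ ((Int.fdiv sh 2 - env - eup : ℤ) : ℝ) := by
    exact_mod_cast hok
  push_cast at hok' hbar h2
  have e : (S : ℝ) * ((eup : ℝ) / S) = eup := by field_simp
  refine le_of_mul_le_mul_left ?_ hS'
  have e2 : (S : ℝ) * (Sr / 2 - Er - (eup : ℝ) / S) = S * (Sr / 2) - S * Er - S * ((eup : ℝ) / S) := by ring
  rw [e2, e]
  linarith

end Summit.AtomisticToContinuum.Crystallization.Theorems.FrustratedLawDichotomyDRowsArith
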